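import Mathlib

/-!
# Route `SymPencil` — inner rank of the `2 | 2` row split of `per_4`, PEELED case: the frame and
# the Lagrangian confinement (`--supports` stmt-ValiantsHypothesis-5674 `SdcSuperquadratic`; (8,8)
# column, memo `NOTE-p6g16-5674-R2-peeled-ten.md` §§1–2)

Abstract linear algebra over a field of characteristic zero (no project imports), stated for the
weighted pairing `⟨x, x'⟩ = Σ_r c_r x_r x'_r` on `κ → K` with all `c_r ≠ 0` and `|κ| = 10`.

* `eq_zero_of_orth_family` — if a finite family `w` has a NON-DEGENERATE Gram pairing and as many
  members as `|κ|`, a vector orthogonal to every `w i` is zero (the family is a basis).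
* `lagrangian_confinement` — the heart of the peeled-ten argument.  Data: a bilinear
  `ν : K⁴ × K⁴ → K^κ` with every `ν(b,y)` isotropic, four pairwise orthogonal isotropic vectors
  `m_l`, an isotropic pair `v₀, v₀'` with `⟨v₀,v₀'⟩ ≠ 0` orthogonal to all `ν(b,y)` and `m_l`, and
  two parameters `y₀, y₁` such that the pairing matrices `P₀ = [2⟨ν(e_b,y₀), m_l⟩]`,
  `P₁ = [2⟨ν(e_b,y₁), m_l⟩]` are symmetric, `P₀` is invertible and the pencil `P₀⁻¹P₁` has the
  Taussky–Zassenhaus property (every alternating `A` with `A S = Sᵀ A` vanishes; supplied by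
  `SymPencilPerFourPeeledTZ` from a cyclic vector or an eigenbasis).  Conclusion: EVERY `ν(b,y)`
  lies in the Lagrangian `span{ν(e_b,y₀)}`, with explicit coordinates `P₀⁻¹ (2⟨ν(b,y), m_l⟩)_l`.
  (Frame `{ν(e_b,y₀), m_l, v₀, v₀'}` = basis of `K^κ`; the cross-Gram `A_y = [⟨ν(e_b,y),ν(e_b',y₀)⟩]`
  is alternating and makes the transition matrix self-adjoint; TZ kills it.)

Honest framing: helper theorem only (the peeled case of the reduced (8,8)-column problem at
`|κ| = 10` follows from it together with the Hessian-pencil witnesses and the flattening-rank lemma,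
memo §§2–3, not in this file); no cell closes here; `27 ≤ sdc(per_4) ≤ 29`, the crux and
`VP ≠ VNP` are untouched.  No definitions, no named facts. [folklore]
-/

noncomputable section

-- single-conjunct layout: Sub = Summit, duplicated namespace component intended
set_option linter.dupNamespace false

namespace Summit.ValiantsHypothesis.ValiantsHypothesis.Theorems.SymPencilPerFourPeeledFrame

open Matrix Finset Module

variable {K : Type*} [Field K]

/-! ### The weighted pairing `Σ_r c_r x_r x'_r`: symmetry, bilinearity, polarisation -/

/-- Symmetry of the weighted pairing. [folklore] -/
theorem wdot_comm {κ : Type*} [Fintype κ] (c x x' : κ → K) :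
    ∑ r, c r * x r * x' r = ∑ r, c r * x' r * x r :=
  Finset.sum_congr rfl fun r _ => by ring

/-- Additivity of the weighted pairing in the first vector. [folklore] -/
theorem wdot_add_left {κ : Type*} [Fintype κ] (c x x'' x' : κ → K) :
    ∑ r, c r * (x + x'') r * x' r = ∑ r, c r * x r * x' r + ∑ r, c r * x'' r * x' r := by
  rw [← Finset.sum_add_distrib]; exact Finset.sum_congr rfl fun r _ => by simp only [Pi.add_apply]; ring

/-- Homogeneity of the weighted pairing in the first vector. [folklore] -/
theorem wdot_smul_left {κ : Type*} [Fintype κ] (c x x' : κ → K) (s : K) :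
    ∑ r, c r * (s • x) r * x' r = s * ∑ r, c r * x r * x' r := by
  rw [Finset.mul_sum]; exact Finset.sum_congr rfl fun r _ => by simp only [Pi.smul_apply, smul_eq_mul]; ring

/-- The weighted pairing against a finite linear combination. [folklore] -/
theorem wdot_sum_smul_left {κ ι : Type*} [Fintype κ] [Fintype ι] (c x' : κ → K) (g : ι → K)
    (w : ι → κ → K) :
    ∑ r, c r * (∑ i, g i • w i) r * x' r = ∑ i, g i * ∑ r, c r * w i r * x' r := by
  simp only [Finset.sum_apply, Pi.smul_apply, smul_eq_mul, Finset.sum_mul, Finset.mul_sum]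
  rw [Finset.sum_comm]
  exact Finset.sum_congr rfl fun i _ => Finset.sum_congr rfl fun r _ => by ring

/-- Polarisation: three isotropic vectors `u, w, u + w` give `⟨u, w⟩ = 0` (characteristic `0`).
[folklore] -/
theorem wdot_eq_zero_of_isotropic [CharZero K] {κ : Type*} [Fintype κ] (c u w : κ → K)
    (hu : ∑ r, c r * u r * u r = 0) (hw : ∑ r, c r * w r * w r = 0)
    (huw : ∑ r, c r * (u + w) r * (u + w) r = 0) : ∑ r, c r * u r * w r = 0 := by
  have h : ∑ r, c r * (u + w) r * (u + w) r =
      ∑ r, c r * u r * u r + ∑ r, c r * w r * w r + 2 * ∑ r, c r * u r * w r := by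
    rw [Finset.mul_sum, ← Finset.sum_add_distrib, ← Finset.sum_add_distrib]
    exact Finset.sum_congr rfl fun r _ => by simp only [Pi.add_apply]; ring
  rw [huw, hu, hw, zero_add, zero_add] at h
  exact (mul_eq_zero.1 h.symm).resolve_left two_ne_zero

/-! ### A family with non-degenerate Gram pairing and `|κ|` members is a basis -/

/-- **Orthogonal to a full non-degenerate family ⇒ zero.**  If `w : ι → K^κ` has a Gram pairing
without kernel (`Σ_i g_i ⟨w_i, w_j⟩ = 0 ∀ j ⇒ g = 0`), `|ι| = |κ|`, and all weights `c_r ≠ 0`, then a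
vector orthogonal to every `w_i` vanishes. [folklore] -/
theorem eq_zero_of_orth_family {κ ι : Type*} [Fintype κ] [DecidableEq κ] [Fintype ι]
    (c : κ → K) (hc : ∀ r, c r ≠ 0) (w : ι → κ → K)
    (hnd : ∀ g : ι → K, (∀ j, ∑ i, g i * ∑ r, c r * w i r * w j r = 0) → g = 0)
    (hcard : Fintype.card ι = Fintype.card κ) (x : κ → K)
    (hx : ∀ i, ∑ r, c r * x r * w i r = 0) : x = 0 := by
  classical
  -- linear independence from non-degeneracy of the Gram pairing
  have hli : LinearIndependent K w := by
    rw [Fintype.linearIndependent_iff]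
    intro g hg
    have h0 : ∀ j, ∑ i, g i * ∑ r, c r * w i r * w j r = 0 := fun j => by
      rw [← wdot_sum_smul_left c (w j) g w, hg]
      simp
    exact fun i => congrFun (hnd g h0) i
  -- hence the family spans
  have hspan : Submodule.span K (Set.range w) = ⊤ := by
    rcases isEmpty_or_nonempty ι with hι | hι
    · have : Fintype.card κ = 0 := by rw [← hcard]; exact Fintype.card_eq_zero
      haveI : IsEmpty κ := Fintype.card_eq_zero_iff.1 this
      ext z; simp [Subsingleton.elim z 0]
    · exact hli.span_eq_top_of_card_eq_finrank (by rw [hcard, Module.finrank_fintype_fun_eq_card])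
  -- the functional `z ↦ ⟨x, z⟩` vanishes on the span, hence everywhere
  let φ : (κ → K) →ₗ[K] K :=
    { toFun := fun z => ∑ r, c r * x r * z r
      map_add' := fun z z' => by
        rw [← Finset.sum_add_distrib]
        exact Finset.sum_congr rfl fun r _ => by simp only [Pi.add_apply]; ring
      map_smul' := fun s z => by
        rw [RingHom.id_apply, smul_eq_mul, Finset.mul_sum]
        exact Finset.sum_congr rfl fun r _ => by simp only [Pi.smul_apply, smul_eq_mul]; ring }
  have hker : Submodule.span K (Set.range w) ≤ LinearMap.ker φ := by
    rw [Submodule.span_le]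
    rintro _ ⟨i, rfl⟩
    exact hx i
  rw [hspan, top_le_iff] at hker
  funext r
  have hr : φ (Pi.single r 1) = 0 := by
    have : (Pi.single r 1 : κ → K) ∈ LinearMap.ker φ := by rw [hker]; trivial
    exact this
  have hval : φ (Pi.single r 1) = c r * x r := by
    change ∑ r', c r' * x r' * (Pi.single r (1 : K) : κ → K) r' = c r * x r
    rw [Finset.sum_eq_single r]
    · simp
    · intro r' _ hr'; simp [hr']
    · intro h; exact absurd (Finset.mem_univ r) h
  rw [hval] at hr
  exact (mul_eq_zero.1 hr).resolve_left (hc r)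

/-! ### The Lagrangian confinement -/

/-- **Lagrangian confinement** (memo §2).  See the module docstring for the data.  Conclusion: every
`ν(b,y)` is the combination `Σ_{b'} (P₀⁻¹ γ)_{b'} ν(e_{b'},y₀)` with `γ_l = 2⟨ν(b,y), m_l⟩`. [folklore] -/
theorem lagrangian_confinement [CharZero K] {κ : Type*} [Fintype κ] [DecidableEq κ]
    (c : κ → K) (hc : ∀ r, c r ≠ 0) (hκ : Fintype.card κ = 10)
    (ν : (Fin 4 → K) →ₗ[K] (Fin 4 → K) →ₗ[K] (κ → K))
    (hν : ∀ b y, ∑ r, c r * ν b y r * ν b y r = 0)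
    (m : Fin 4 → κ → K) (hm : ∀ l l', ∑ r, c r * m l r * m l' r = 0)
    (v₀ v₀' : κ → K)
    (hv₀ν : ∀ b y, ∑ r, c r * ν b y r * v₀ r = 0) (hv₀'ν : ∀ b y, ∑ r, c r * ν b y r * v₀' r = 0)
    (hv₀m : ∀ l, ∑ r, c r * m l r * v₀ r = 0) (hv₀'m : ∀ l, ∑ r, c r * m l r * v₀' r = 0)
    (hv₀₀ : ∑ r, c r * v₀ r * v₀ r = 0) (hv₀'₀' : ∑ r, c r * v₀' r * v₀' r = 0)
    (hlam : ∑ r, c r * v₀ r * v₀' r ≠ 0)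
    (y₀ y₁ : Fin 4 → K) (P₀ P₁ : Matrix (Fin 4) (Fin 4) K)
    (hP₀ : ∀ b l, P₀ b l = 2 * ∑ r, c r * ν (Pi.single b 1) y₀ r * m l r)
    (hP₁ : ∀ b l, P₁ b l = 2 * ∑ r, c r * ν (Pi.single b 1) y₁ r * m l r)
    (hP₀s : P₀ᵀ = P₀) (hP₁s : P₁ᵀ = P₁) (hdet : IsUnit P₀.det)
    (htz : ∀ A : Matrix (Fin 4) (Fin 4) K, Aᵀ = -A →
      A * (P₀⁻¹ * P₁) = (P₀⁻¹ * P₁)ᵀ * A → A = 0) :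
    ∀ b y, ν b y =
      ∑ b', (P₀⁻¹ *ᵥ (fun l => 2 * ∑ r, c r * ν b y r * m l r)) b' • ν (Pi.single b' 1) y₀ := by
  classical
  -- the frame vectors `n_b`
  set n : Fin 4 → κ → K := fun b => ν (Pi.single b 1) y₀ with hn
  have hP0inv : P₀ * P₀⁻¹ = 1 := Matrix.mul_nonsing_inv P₀ hdet
  have hP0inv' : P₀⁻¹ * P₀ = 1 := Matrix.nonsing_inv_mul P₀ hdet
  have hP0invT : (P₀⁻¹)ᵀ = P₀⁻¹ := by rw [Matrix.transpose_nonsing_inv, hP₀s]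
  -- polarised isotropy
  have pol1 : ∀ b b' y, ∑ r, c r * ν b y r * ν b' y r = 0 := fun b b' y =>
    wdot_eq_zero_of_isotropic c _ _ (hν b y) (hν b' y) (by
      have : ν b y + ν b' y = ν (b + b') y := by rw [map_add, LinearMap.add_apply]
      rw [this]; exact hν _ _)
  have pol3 : ∀ b b' y y',
      ∑ r, c r * ν b y r * ν b' y' r + ∑ r, c r * ν b y' r * ν b' y r = 0 := by
    intro b b' y y'
    have h := pol1 b b' (y + y')
    have e1 : ν b (y + y') = ν b y + ν b y' := by rw [map_add]
    have e2 : ν b' (y + y') = ν b' y + ν b' y' := by rw [map_add]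
    rw [e1, e2, wdot_add_left, wdot_comm c (ν b y), wdot_comm c (ν b y'), wdot_add_left,
      wdot_add_left, wdot_comm c (ν b' y) (ν b y), pol1, wdot_comm c (ν b' y') (ν b y'), pol1] at h
    rw [wdot_comm c (ν b y), wdot_comm c (ν b y')]
    linear_combination h
  -- Gram values of the frame
  have gnn : ∀ b b', ∑ r, c r * n b r * n b' r = 0 := fun b b' => pol1 _ _ _
  have gnm : ∀ b l, ∑ r, c r * n b r * m l r = P₀ b l / 2 := fun b l => by
    rw [hP₀]; ring
  have gmn : ∀ l b, ∑ r, c r * m l r * n b r = P₀ b l / 2 := fun l b => by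
    rw [wdot_comm]; exact gnm b l
  have gnv : ∀ b, ∑ r, c r * n b r * v₀ r = 0 := fun b => hv₀ν _ _
  have gnv' : ∀ b, ∑ r, c r * n b r * v₀' r = 0 := fun b => hv₀'ν _ _
  have gvm : ∀ l, ∑ r, c r * v₀ r * m l r = 0 := fun l => by rw [wdot_comm]; exact hv₀m l
  have gv'm : ∀ l, ∑ r, c r * v₀' r * m l r = 0 := fun l => by rw [wdot_comm]; exact hv₀'m l
  have gvn : ∀ b, ∑ r, c r * v₀ r * n b r = 0 := fun b => by rw [wdot_comm]; exact gnv b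
  have gv'n : ∀ b, ∑ r, c r * v₀' r * n b r = 0 := fun b => by rw [wdot_comm]; exact gnv' b
  have gv'v : ∑ r, c r * v₀' r * v₀ r = ∑ r, c r * v₀ r * v₀' r := wdot_comm c _ _
  -- the frame family, indexed by `(Fin 4 ⊕ Fin 4) ⊕ Fin 2`
  let w : (Fin 4 ⊕ Fin 4) ⊕ Fin 2 → κ → K :=
    fun i => Sum.elim (Sum.elim n m) ![v₀, v₀'] i
  have hcard : Fintype.card ((Fin 4 ⊕ Fin 4) ⊕ Fin 2) = Fintype.card κ := by
    rw [hκ]; simp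
  -- non-degeneracy of the frame's Gram pairing
  have hnd : ∀ g : (Fin 4 ⊕ Fin 4) ⊕ Fin 2 → K,
      (∀ j, ∑ i, g i * ∑ r, c r * w i r * w j r = 0) → g = 0 := by
    intro g hg
    have eqm : ∀ l, ∑ b, g (Sum.inl (Sum.inl b)) * P₀ b l = 0 := by
      intro l
      have h := hg (Sum.inl (Sum.inr l))
      simp only [w, Fintype.sum_sum_type, Fin.sum_univ_two, Sum.elim_inl, Sum.elim_inr,
        Matrix.cons_val_zero, Matrix.cons_val_one, gnm, hm, gvm, gv'm,
        mul_zero, add_zero, Finset.sum_const_zero] at h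
      have : ∑ b, g (Sum.inl (Sum.inl b)) * P₀ b l =
          2 * ∑ b, g (Sum.inl (Sum.inl b)) * (P₀ b l / 2) := by
        rw [Finset.mul_sum]; exact Finset.sum_congr rfl fun b _ => by ring
      rw [this, h, mul_zero]
    have eqn : ∀ b, ∑ l, g (Sum.inl (Sum.inr l)) * P₀ b l = 0 := by
      intro b
      have h := hg (Sum.inl (Sum.inl b))
      simp only [w, Fintype.sum_sum_type, Fin.sum_univ_two, Sum.elim_inl, Sum.elim_inr,
        Matrix.cons_val_zero, Matrix.cons_val_one, gnn, gmn, gvn, gv'n,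
        mul_zero, add_zero, zero_add, Finset.sum_const_zero] at h
      have : ∑ l, g (Sum.inl (Sum.inr l)) * P₀ b l =
          2 * ∑ l, g (Sum.inl (Sum.inr l)) * (P₀ b l / 2) := by
        rw [Finset.mul_sum]; exact Finset.sum_congr rfl fun l _ => by ring
      rw [this, h, mul_zero]
    have eqv : g (Sum.inr 0) * ∑ r, c r * v₀ r * v₀' r = 0 := by
      have h := hg (Sum.inr 1)
      simp only [w, Fintype.sum_sum_type, Fin.sum_univ_two, Sum.elim_inl, Sum.elim_inr,
        Matrix.cons_val_zero, Matrix.cons_val_one, gnv', hv₀'m, hv₀'₀',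
        mul_zero, add_zero, zero_add, Finset.sum_const_zero] at h
      exact h
    have eqv' : g (Sum.inr 1) * ∑ r, c r * v₀ r * v₀' r = 0 := by
      have h := hg (Sum.inr 0)
      simp only [w, Fintype.sum_sum_type, Fin.sum_univ_two, Sum.elim_inl, Sum.elim_inr,
        Matrix.cons_val_zero, Matrix.cons_val_one, gnv, hv₀m, hv₀₀,
        mul_zero, add_zero, zero_add, Finset.sum_const_zero] at h
      rw [gv'v] at h
      exact h
    have hgn : (fun b => g (Sum.inl (Sum.inl b))) = 0 := by
      have h1 : (fun b => g (Sum.inl (Sum.inl b))) ᵥ* P₀ = 0 := by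
        funext l; simpa [vecMul, dotProduct] using eqm l
      have h2 := congrArg (fun v => v ᵥ* P₀⁻¹) h1
      simpa only [vecMul_vecMul, hP0inv, vecMul_one, zero_vecMul] using h2
    have hgm : (fun l => g (Sum.inl (Sum.inr l))) = 0 := by
      have h1 : P₀ *ᵥ (fun l => g (Sum.inl (Sum.inr l))) = 0 := by
        funext b; simpa [mulVec, dotProduct, mul_comm] using eqn b
      have h2 := congrArg (fun v => P₀⁻¹ *ᵥ v) h1
      simpa only [mulVec_mulVec, hP0inv', one_mulVec, mulVec_zero] using h2
    funext i
    rcases i with (b | l) | t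
    · exact congrFun hgn b
    · exact congrFun hgm l
    · fin_cases t
      · exact (mul_eq_zero.1 eqv).resolve_right hlam
      · exact (mul_eq_zero.1 eqv').resolve_right hlam
  -- EXPANSION of a vector orthogonal to `v₀, v₀'` in the frame `n, m`
  have expand : ∀ x : κ → K, (∑ r, c r * x r * v₀ r = 0) → (∑ r, c r * x r * v₀' r = 0) →
      x = ∑ b', (P₀⁻¹ *ᵥ (fun l => 2 * ∑ r, c r * x r * m l r)) b' • n b' +
          ∑ l, (P₀⁻¹ *ᵥ (fun b' => 2 * ∑ r, c r * x r * n b' r)) l • m l := by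
    intro x hx0 hx0'
    set σ : Fin 4 → K := P₀⁻¹ *ᵥ (fun l => 2 * ∑ r, c r * x r * m l r) with hσ
    set τ : Fin 4 → K := P₀⁻¹ *ᵥ (fun b' => 2 * ∑ r, c r * x r * n b' r) with hτ
    have hPσ : P₀ *ᵥ σ = fun l => 2 * ∑ r, c r * x r * m l r := by
      rw [hσ, mulVec_mulVec, hP0inv, one_mulVec]
    have hPτ : P₀ *ᵥ τ = fun b' => 2 * ∑ r, c r * x r * n b' r := by
      rw [hτ, mulVec_mulVec, hP0inv, one_mulVec]
    set xh : κ → K := x - (∑ b', σ b' • n b' + ∑ l, τ l • m l) with hxh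
    have hsub : ∀ z : κ → K, ∑ r, c r * xh r * z r =
        ∑ r, c r * x r * z r - (∑ b', σ b' * ∑ r, c r * n b' r * z r +
          ∑ l, τ l * ∑ r, c r * m l r * z r) := by
      intro z
      rw [hxh, ← wdot_sum_smul_left, ← wdot_sum_smul_left, ← wdot_add_left,
        ← Finset.sum_sub_distrib]
      exact Finset.sum_congr rfl fun r _ => by simp only [Pi.sub_apply]; ring
    have key : xh = 0 := by
      refine eq_zero_of_orth_family c hc w hnd hcard xh (fun i => ?_)
      rcases i with (b | l) | t
      · -- against `n_b`
        change ∑ r, c r * xh r * n b r = 0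
        rw [hsub]
        simp only [gnn, mul_zero, Finset.sum_const_zero, zero_add, gmn]
        have h1 : ∑ l, τ l * (P₀ b l / 2) = (P₀ *ᵥ τ) b / 2 := by
          simp only [mulVec, dotProduct, Finset.sum_div]
          exact Finset.sum_congr rfl fun l _ => by ring
        rw [h1, hPτ]; ring
      · -- against `m_l`
        change ∑ r, c r * xh r * m l r = 0
        rw [hsub]
        simp only [gnm, hm, mul_zero, Finset.sum_const_zero, add_zero]
        have h1 : ∑ b', σ b' * (P₀ b' l / 2) = (P₀ᵀ *ᵥ σ) l / 2 := by
          simp only [mulVec, dotProduct, transpose_apply, Finset.sum_div]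
          exact Finset.sum_congr rfl fun b' _ => by ring
        rw [h1, hP₀s, hPσ]; ring
      · fin_cases t
        · change ∑ r, c r * xh r * v₀ r = 0
          rw [hsub]; simp [gnv, hv₀m, hx0]
        · change ∑ r, c r * xh r * v₀' r = 0
          rw [hsub]; simp [gnv', hv₀'m, hx0']
    rw [hxh, sub_eq_zero] at key
    exact key
  -- the cross-Gram `A y` (against the frame `n`) and the transition matrix `S y` (n-coordinates)
  let A : (Fin 4 → K) → Matrix (Fin 4) (Fin 4) K :=
    fun y => Matrix.of fun b' b => ∑ r, c r * ν (Pi.single b 1) y r * n b' r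
  let S : (Fin 4 → K) → Matrix (Fin 4) (Fin 4) K :=
    fun y => Matrix.of fun b' b =>
      (P₀⁻¹ *ᵥ (fun l => 2 * ∑ r, c r * ν (Pi.single b 1) y r * m l r)) b'
  have hAalt : ∀ y, (A y)ᵀ = -(A y) := by
    intro y; ext b b'
    have h := pol3 (Pi.single b' 1) (Pi.single b 1) y y₀
    rw [wdot_comm c (ν (Pi.single b' 1) y₀)] at h
    simp only [A, transpose_apply, Matrix.neg_apply, Matrix.of_apply]
    linear_combination h
  have hScol : ∀ y b', (fun b'' => S y b'' b') =
      P₀⁻¹ *ᵥ (fun l => 2 * ∑ r, c r * ν (Pi.single b' 1) y r * m l r) := by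
    intro y b'; funext b''; rfl
  -- the pairing formula
  have pair : ∀ b b' y y', ∑ r, c r * ν (Pi.single b 1) y r * ν (Pi.single b' 1) y' r =
      ((S y)ᵀ * A y' - A y * S y') b b' := by
    intro b b' y y'
    set τx : Fin 4 → K :=
      P₀⁻¹ *ᵥ (fun b'' => 2 * ∑ r, c r * ν (Pi.single b 1) y r * n b'' r) with hτx
    have hPτ : P₀ *ᵥ τx = fun b'' => 2 * A y b'' b := by
      rw [hτx, mulVec_mulVec, hP0inv, one_mulVec]; rfl
    have hx := expand (ν (Pi.single b 1) y) (hv₀ν _ _) (hv₀'ν _ _)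
    rw [← hScol y b, ← hτx] at hx
    conv_lhs => rw [hx]
    rw [wdot_add_left, wdot_sum_smul_left, wdot_sum_smul_left]
    have e1 : ∀ b'', ∑ r, c r * n b'' r * ν (Pi.single b' 1) y' r = A y' b'' b' := by
      intro b''; rw [wdot_comm]; rfl
    have e2 : ∀ l, ∑ r, c r * m l r * ν (Pi.single b' 1) y' r =
        (P₀ *ᵥ fun b'' => S y' b'' b') l / 2 := by
      intro l
      rw [hScol y' b', mulVec_mulVec, hP0inv, one_mulVec, wdot_comm c (m l)]; ring
    simp only [e1, e2]
    have e3 : ∑ l, τx l * ((P₀ *ᵥ fun b'' => S y' b'' b') l / 2) =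
        ∑ b'', A y b'' b * S y' b'' b' := by
      have h1 : ∑ l, τx l * ((P₀ *ᵥ fun b'' => S y' b'' b') l / 2) =
          (τx ⬝ᵥ (P₀ *ᵥ fun b'' => S y' b'' b')) / 2 := by
        simp only [dotProduct, Finset.sum_div]
        exact Finset.sum_congr rfl fun l _ => by ring
      rw [h1, dotProduct_mulVec, ← mulVec_transpose, hP₀s, hPτ]
      simp only [dotProduct, Finset.sum_div]
      exact Finset.sum_congr rfl fun b'' _ => by ring
    rw [e3]
    have e4 : ∀ b'', A y b'' b = -A y b b'' := fun b'' => by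
      have := congrFun (congrFun (hAalt y) b) b''
      simpa only [transpose_apply, Matrix.neg_apply] using this
    simp only [e4, Matrix.sub_apply, Matrix.mul_apply, transpose_apply, neg_mul,
      Finset.sum_neg_distrib, sub_eq_add_neg]
  -- the transition matrix at `y₁` is the pencil `P₀⁻¹ P₁`
  have hS1 : S y₁ = P₀⁻¹ * P₁ := by
    ext b' b
    simp only [S, Matrix.of_apply, mulVec, dotProduct, Matrix.mul_apply]
    refine Finset.sum_congr rfl fun l _ => ?_
    have hsym : P₁ l b = P₁ b l := by
      have := congrFun (congrFun hP₁s l) b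
      simpa only [transpose_apply] using this.symm
    rw [hsym, hP₁]
  -- Taussky–Zassenhaus at `y₁`: `A y₁ = 0`
  have hA1 : A y₁ = 0 := by
    refine htz (A y₁) (hAalt y₁) ?_
    rw [← hS1]
    have h : (S y₁)ᵀ * A y₁ - A y₁ * S y₁ = 0 := by
      ext b b'
      rw [← pair b b' y₁ y₁, Matrix.zero_apply]
      exact pol1 _ _ _
    rw [sub_eq_zero] at h
    exact h.symm
  -- then at every `y`: `A y = 0`
  have hAy : ∀ y, A y = 0 := by
    intro y
    refine htz (A y) (hAalt y) ?_
    rw [← hS1]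
    have h : (S y₁)ᵀ * A y - A y * S y₁ = 0 := by
      ext b b'
      have h3 := pol3 (Pi.single b 1) (Pi.single b' 1) y y₁
      rw [pair b b' y y₁, pair b b' y₁ y, hA1, Matrix.mul_zero, Matrix.zero_mul, zero_sub,
        sub_zero, Matrix.neg_apply] at h3
      rw [Matrix.sub_apply, Matrix.zero_apply]
      linear_combination h3
    rw [sub_eq_zero] at h
    exact h.symm
  -- conclusion
  intro b y
  have hb : ν b y = ∑ i, b i • ν (Pi.single i 1) y := by
    have : b = ∑ i, b i • (Pi.single i 1 : Fin 4 → K) := by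
      ext j
      simp only [Finset.sum_apply, Pi.smul_apply, Pi.single_apply, smul_eq_mul, mul_ite,
        mul_one, mul_zero]
      rw [Finset.sum_ite_eq]; simp
    conv_lhs => rw [this]
    rw [map_sum, LinearMap.sum_apply]
    exact Finset.sum_congr rfl fun i _ => by rw [map_smul, LinearMap.smul_apply]
  have hτ0 : (fun b' => 2 * ∑ r, c r * ν b y r * n b' r) = 0 := by
    funext b'
    rw [Pi.zero_apply, hb, wdot_sum_smul_left]
    have : ∀ i, ∑ r, c r * ν (Pi.single i 1) y r * n b' r = A y b' i := fun i => rfl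
    simp only [this, hAy y, Matrix.zero_apply, mul_zero, Finset.sum_const_zero]
  have hx := expand (ν b y) (hv₀ν _ _) (hv₀'ν _ _)
  rw [hτ0, mulVec_zero] at hx
  simpa using hx

end Summit.ValiantsHypothesis.ValiantsHypothesis.Theorems.SymPencilPerFourPeeledFrame

end
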